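import Summits.AtomisticToContinuum.Crystallization.Theorems.FrustratedLawDichotomySphericalGauge
import Summits.AtomisticToContinuum.Crystallization.Theorems.FrustratedLawDichotomySphericalPairBound

/-!
# FrustratedLawDichotomy · crux `AperiodicFrustratedLawGap` (stmt-AtomisticToContinuum-27623) — THE ROTATION GAUGE FOR P ON THE SPHERE:
# `SphericalPairBound θ c ρ Pat ⟸ GaugedSphericalPairBound θ c ρ Pat u₀ u₁` (decomp-a2c, prover hand 2, gen 11)

Companion of `…SphericalGauge` (G) and `…LinkPairBoundGauge` (P in coordinates): the spherical form of P's scalar bounds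
(`SphericalPairBound`, p825795) with the rotation gauge fixed by a pattern contact pair `(u₀, u₁)` — `e u₀` the north pole, `e u₁` on the
half-meridian `{y = 0, x ≥ 0}` — so that a certificate runs on a compact `21`-parameter domain.

* `GaugedSphericalPairBound θ c ρ Pat u₀ u₁`;
* ★ `sphericalPairBound_of_gauged : dist u₀ u₁ = 1 → 0 ≤ θ → θ < 1 → GaugedSphericalPairBound … u₀ u₁ → SphericalPairBound θ c ρ Pat`;
* literals (`θ = 1/100`): `linkPairBound_sqrt3_of_gaugedSpherical` (`c = −257/625 ⟹ D₀ = 42/25`), `linkDiagonalBound_of_gaugedSpherical`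
  (`c = 7/25 ⟹ d₀ = 6/5`).
`[folklore]`; one definition; no `sorry`; no `instance`/`notation`.
-/

noncomputable section

namespace Summit.AtomisticToContinuum.Crystallization.Theorems.FrustratedLawDichotomySphericalPairGauge

open Real RealInnerProductSpace
open Literature.Geometry.DiscreteGeometry
open Summit.AtomisticToContinuum.Crystallization.Theorems.FrustratedLawDichotomyTwoShellRigidityCut (E3)
open Summit.AtomisticToContinuum.Crystallization.Theorems.FrustratedLawDichotomyCapMatchOfDiagonal (LinkDiagonalBound)
open Summit.AtomisticToContinuum.Crystallization.Theorems.FrustratedLawDichotomyNoTwistOfPairBound (LinkPairBound)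
open Summit.AtomisticToContinuum.Crystallization.Theorems.FrustratedLawDichotomySphericalGauge (exists_adapted_basis)
open Summit.AtomisticToContinuum.Crystallization.Theorems.FrustratedLawDichotomySphericalPairBound
  (SphericalPairBound linkPairBound_sqrt3_of_spherical linkDiagonalBound_of_spherical)

/-! ### §1 The gauged statement -/

/-- **`GaugedSphericalPairBound θ c ρ Pat u₀ u₁`** — `SphericalPairBound θ c ρ Pat` restricted to gauge-fixed tuples: `e u₀ = (0, 0, 1)` and
`e u₁` on the half-meridian `y = 0, x ≥ 0`. [certificate target; 21 parameters] -/
def GaugedSphericalPairBound (θ c ρ : ℝ) (Pat : Finset E3) (u₀ u₁ : ↥Pat) : Prop :=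
  ∀ e : ↥Pat → E3,
    (∀ u, ‖e u‖ = 1) →
    (e u₀ 0 = 0 ∧ e u₀ 1 = 0 ∧ e u₀ 2 = 1) → (e u₁ 1 = 0 ∧ 0 ≤ e u₁ 0) →
    (∀ u v : ↥Pat, u ≠ v → ⟪e u, e v⟫ ≤ 1 - (1 + θ)⁻¹ ^ 2 / 2) →
    (∀ u v : ↥Pat, dist (u : E3) (v : E3) = 1 → 1 - (1 + θ) ^ 2 / 2 ≤ ⟪e u, e v⟫) →
    (∀ u v : ↥Pat, u ≠ v → dist (u : E3) (v : E3) ≠ 1 → ⟪e u, e v⟫ < (1 + θ) / 2) →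
    ∀ a b : ↥Pat, dist (a : E3) (b : E3) = ρ → ⟪e a, e b⟫ ≤ c

/-! ### §2 The reduction -/

/-- ★ **THE GAUGE REDUCTION `GaugedSphericalPairBound θ c ρ Pat u₀ u₁ → SphericalPairBound θ c ρ Pat`** for a pattern contact pair
`(u₀, u₁)` (`0 ≤ θ < 1`). [folklore] -/
theorem sphericalPairBound_of_gauged {θ c ρ : ℝ} {Pat : Finset E3} {u₀ u₁ : ↥Pat} (h01 : dist (u₀ : E3) (u₁ : E3) = 1)
    (hθ : 0 ≤ θ) (hθ1 : θ < 1) (hG : GaugedSphericalPairBound θ c ρ Pat u₀ u₁) : SphericalPairBound θ c ρ Pat := by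
  intro e hunit hall hbond hnon a b₀ hab
  have hne01 : u₀ ≠ u₁ := by
    intro h; rw [h, dist_self] at h01; exact zero_ne_one h01
  have ht : ⟪e u₀, e u₁⟫ ^ 2 < 1 := by
    have h1 : ⟪e u₀, e u₁⟫ ≤ 1 - (1 + θ)⁻¹ ^ 2 / 2 := hall u₀ u₁ hne01
    have h2 : 1 - (1 + θ) ^ 2 / 2 ≤ ⟪e u₀, e u₁⟫ := hbond u₀ u₁ h01
    have h3 : 0 < (1 + θ)⁻¹ ^ 2 := by positivity
    have h4 : (1 + θ) ^ 2 < 4 := by nlinarith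
    have hlo : -1 < ⟪e u₀, e u₁⟫ := by linarith
    have hhi : ⟪e u₀, e u₁⟫ < 1 := by linarith
    nlinarith
  obtain ⟨b, hb2, hb1m, hb0m⟩ := exists_adapted_basis (hunit u₀) (hunit u₁) ht
  set e' : ↥Pat → E3 := fun u => b.repr (e u) with he'
  have hinner : ∀ u w, ⟪e' u, e' w⟫ = ⟪e u, e w⟫ := fun u w => b.repr.inner_map_map (e u) (e w)
  have hnorm : ∀ u, ‖e' u‖ = 1 := fun u => by rw [he', LinearIsometryEquiv.norm_map]; exact hunit u
  have hcoord : ∀ u (i : Fin 3), e' u i = ⟪b i, e u⟫ := fun u i => b.repr_apply_apply (e u) i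
  have hnn : ⟪e u₀, e u₀⟫ = 1 := by rw [real_inner_self_eq_norm_sq, hunit u₀]; norm_num
  have key := hG e' hnorm ⟨?_, ?_, ?_⟩ ⟨?_, ?_⟩ (fun u v huv => (hinner u v).symm ▸ hall u v huv)
    (fun u v huv => (hinner u v).symm ▸ hbond u v huv) (fun u v huv hn => (hinner u v).symm ▸ hnon u v huv hn) a b₀ hab
  · rwa [hinner] at key
  · rw [hcoord, ← hb2]; exact b.orthonormal.inner_eq_zero (by decide)
  · rw [hcoord, ← hb2]; exact b.orthonormal.inner_eq_zero (by decide)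
  · rw [hcoord, hb2, hnn]
  · rw [hcoord]; exact hb1m
  · rw [hcoord]; exact hb0m

/-! ### §3 Literals at `θ = 1/100` -/

/-- **`√3`-pairs from the gauged spherical statement**: `c = −257/625 ⟹ LinkPairBound (1/100) (42/25) √3 Pat`. [folklore] -/
theorem linkPairBound_sqrt3_of_gaugedSpherical {Pat : Finset E3} {u₀ u₁ : ↥Pat} (h01 : dist (u₀ : E3) (u₁ : E3) = 1)
    (h : GaugedSphericalPairBound (1 / 100) (-257 / 625) (Real.sqrt 3) Pat u₀ u₁) :
    LinkPairBound (1 / 100) (42 / 25) (Real.sqrt 3) Pat :=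
  linkPairBound_sqrt3_of_spherical (sphericalPairBound_of_gauged h01 (by norm_num) (by norm_num) h)

/-- **Square diagonals from the gauged spherical statement**: `c = 7/25 ⟹ LinkDiagonalBound (1/100) (6/5) Pat`. [folklore] -/
theorem linkDiagonalBound_of_gaugedSpherical {Pat : Finset E3} {u₀ u₁ : ↥Pat} (h01 : dist (u₀ : E3) (u₁ : E3) = 1)
    (h : GaugedSphericalPairBound (1 / 100) (7 / 25) (Real.sqrt 2) Pat u₀ u₁) : LinkDiagonalBound (1 / 100) (6 / 5) Pat :=
  linkDiagonalBound_of_spherical (sphericalPairBound_of_gauged h01 (by norm_num) (by norm_num) h)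

end Summit.AtomisticToContinuum.Crystallization.Theorems.FrustratedLawDichotomySphericalPairGauge

end
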